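import Summits.BirchSwinnertonDyer.BirchSwinnertonDyer.Theorems.ResidualThetaTransportAtTwoSignedControlAtTwoOfPub
import HarnessLib

/-!
# K4P on route `ThetaPartnerAtTwo` (TP2): `SignedControlAtTwoOfPub` (item stmt-BirchSwinnertonDyer-24946) BY NAME

The PHASE T (reduced) edit of route `ThetaPartnerAtTwo` (pen `bsd-wall-p2` g15, rev 20–22, 2026-08-28) added the twin
`Summit.BirchSwinnertonDyer.BirchSwinnertonDyer.Theses.ThetaPartnerAtTwo.SignedControlAtTwoOfPub`, whose text is VERBATIM that of the
route-`ResidualThetaTransportAtTwo` item stmt-BirchSwinnertonDyer-24144, already PROVED in the tree by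
`Summit.BirchSwinnertonDyer.BirchSwinnertonDyer.Theorems.SignedControlAtTwoOfPub_proof` (K4 lead `bsd-wall-tp2-p3`, file
`Theorems/ResidualThetaTransportAtTwoSignedControlAtTwoOfPub.lean`). The two `def`s unfold to the same proposition, so the TP2 item is
closed by the same proof term. Width seat `bsd-wall-tp2-p2x-w2` g3 (cell `bsd-wall`), at the route pen's request (bus 02:56:43Z (γ)).
HONEST FRAMING: conditional on the five printed Greenberg/Kato facts that are the antecedents of the statement itself; BSD is NOT proved
by this.
-/

set_option autoImplicit false
-- the Theorems namespace of this sub repeats the summit name by design (D-0017 nested layout)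
set_option linter.dupNamespace false

namespace Summit.BirchSwinnertonDyer.BirchSwinnertonDyer.Theorems

/-- **K4P on TP2**: the five printed facts (Greenberg 1999: Cassels surjectivity for `H¹_Σ`, Prop. 4.12 no finite submodule, the
`H¹_Σ` corank bound, local-quotient surjectivity; weak Leopoldt rank one) BY NAME imply K4 `SignedControlAtTwo` verbatim — the TP2 copy of
the RTT item 24144, proved by the same term `SignedControlAtTwoOfPub_proof`. [cite: BDKim2013, Cor. 3.15 (p. 199)]
[cite: Kobayashi2003, Thm. 1.2, Thm. 9.3] [cite: GreenbergLNM1716, Prop. 4.12, Prop. 4.13] -/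
theorem signedControlAtTwoOfPub_tp2_proof :
    Summit.BirchSwinnertonDyer.BirchSwinnertonDyer.Theses.ThetaPartnerAtTwo.SignedControlAtTwoOfPub :=
  SignedControlAtTwoOfPub_proof

end Summit.BirchSwinnertonDyer.BirchSwinnertonDyer.Theorems
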